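import Summits.Parity.BatemanHorn.Theorems.RoughValueTransportBalancedSemiprimeLayerRootLevelTransfer
import Summits.Parity.BatemanHorn.Theorems.BalancedSemiprimeLayer.Negative.LargePrimeFactors
import HarnessLib

/-!
# Route `RoughValueTransport`, crux `BalancedSemiprimeLayer` (stmt-Parity-9469), line `Ideator4Sketch`:
# the δ-BLIND window-mass bound (what level-`x` information gives toward the atom H1)

The open atom H1 (`RelativeMassSplit.stub_windowMass_highDegree`, skeleton
`Cruxes/BalancedSemiprimeLayer/Lines/Ideator4Sketch.lean`) asks, for an irreducible `g` of degree `d ≥ 3`,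
for a constant `C` NOT depending on `δ` with, eventually in `x`,
`Σ_{m ∈ roughDivWindow d δ c x} #{1 ≤ n ≤ x : m ∣ g(n)} ≤ C·δ·x`.
This file records the elementary half of that statement, which is all that divisibility information below
the number of terms yields (lead seat c4's casework bound (T), kernel-checked here): the same sum is
`≤ 2^{⌊(d+1)/c⌋}·x` eventually, for EVERY `δ ≤ 1` — because each `1 ≤ n ≤ x` carries at most
`2^{⌊(d+1)/c⌋}` squarefree divisors of `g(n) ≠ 0` all of whose prime factors exceed `x^c`
(`x^{c·#P} ≤ ∏_{p ∈ P} p ≤ |g(n)| < x^{d+1}` for the set `P` of such primes).  The factor `δ` — the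
localisation of these divisors to the balanced window `[x^{d(1−δ)/2}, x^{d(1+δ)/2}]` — is exactly the open
content of H1 (dead zone `(1 + c_LPF, d − 1 − c_LPF)` of the large-prime mass profile).

* `card_filter_roughSqfree_dvd_le_two_pow` — rough squarefree divisors of `N ≠ 0` inject into subsets of
  the rough prime factors of `N`;
* `card_roughPrimeFactors_le` — `N ≠ 0`, `N < z^{K+1}` ⟹ at most `K` prime factors `> z`
  (used with `z = x^c`, `K = ⌊(d+1)/c⌋`); `card_filter_roughDivWindow_dvd_le` — the per-`n` count;
* `windowMass_le_two_pow_mul` — the δ-blind bound, in the exact shape of H1's left-hand side.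

References: the line card `Cruxes/BalancedSemiprimeLayer/Lines/Ideator4Sketch.md`; P. Erdős, J. London
Math. Soc. 27 (1952) 7–15, §2 (bounded number of large prime factors of polynomial values — the same
counting). Everything used is PROVED in the tree.
-/

noncomputable section

open Polynomial Filter Finset
open Literature.NumberTheory.Sieve
open scoped BigOperators

namespace Summit.Parity.BatemanHorn.Cruxes.BalancedSemiprimeLayer.RelativeMassSplit

open Summit.Parity.BatemanHorn.Cruxes.BalancedSemiprimeLayer.RoughRelaxedDivisorSieve
  (roughDivWindow divWindow mem_roughDivWindow eval_ne_zero_of_irreducible_of_two_le)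
open Summit.Parity.BatemanHorn.Theorems.BalancedSemiprimeLayer.Negative (abs_eval_natCast_le_mul_pow)

/-! ### Rough squarefree divisors of one integer -/

/-- **Rough squarefree divisors are few.**  For `N ≠ 0` and any finset `T` of moduli, the `m ∈ T` that are
squarefree, have every prime factor `> z`, and divide `N`, number at most `2^{#P}` where `P` is the set of
prime factors `p > z` of `N`: `m ↦ m.primeFactors` is an injection into the subsets of `P`
(`∏_{p ∣ m} p = m` for squarefree `m`). [folklore] -/
theorem card_filter_roughSqfree_dvd_le_two_pow (T : Finset ℕ) {N : ℕ} (hN : N ≠ 0) (z : ℝ) :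
    #(T.filter fun m : ℕ => Squarefree m ∧ (∀ p ∈ m.primeFactors, z < (p : ℝ)) ∧ m ∣ N) ≤
      2 ^ #(N.primeFactors.filter fun p : ℕ => z < (p : ℝ)) := by
  rw [← Finset.card_powerset]
  refine Finset.card_le_card_of_injOn (fun m : ℕ => m.primeFactors) ?_ ?_
  · intro m hm
    rw [Finset.mem_coe, mem_filter] at hm
    obtain ⟨-, -, hrough, hdvd⟩ := hm
    rw [Finset.mem_coe, Finset.mem_powerset]
    intro p hp
    rw [mem_filter]
    exact ⟨Nat.primeFactors_mono hdvd hN hp, hrough p hp⟩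
  · intro m₁ hm₁ m₂ hm₂ h
    rw [Finset.mem_coe, mem_filter] at hm₁ hm₂
    have h1 := Nat.prod_primeFactors_of_squarefree hm₁.2.1
    have h2 := Nat.prod_primeFactors_of_squarefree hm₂.2.1
    simp only at h
    rw [← h1, ← h2, h]

/-- **The number of rough prime factors is bounded by size.**  If `0 < z`, `N ≠ 0` and
`(N : ℝ) < z ^ (K + 1)`, then `N` has at most `K` prime factors `p > z`
(`z^{#P} ≤ ∏_{p ∈ P} p ≤ N`). [folklore] -/
theorem card_roughPrimeFactors_le {N : ℕ} (hN : N ≠ 0) {z : ℝ} (hz : 0 < z) {K : ℕ}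
    (hNz : (N : ℝ) < z ^ (K + 1)) : #(N.primeFactors.filter fun p : ℕ => z < (p : ℝ)) ≤ K := by
  set P := (N.primeFactors.filter fun p : ℕ => z < (p : ℝ)) with hP
  have hsub : P ⊆ N.primeFactors := Finset.filter_subset _ _
  have hdvd : (∏ p ∈ P, p) ∣ N :=
    (Finset.prod_dvd_prod_of_subset _ _ _ hsub).trans (Nat.prod_primeFactors_dvd N)
  have hle : ((∏ p ∈ P, p : ℕ) : ℝ) ≤ N := by exact_mod_cast Nat.le_of_dvd (Nat.pos_of_ne_zero hN) hdvd
  have hpow : z ^ #P ≤ ((∏ p ∈ P, p : ℕ) : ℝ) := by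
    push_cast
    rw [← Finset.prod_const]
    refine Finset.prod_le_prod (fun _ _ => hz.le) fun p hp => ?_
    rw [hP, mem_filter] at hp
    exact hp.2.le
  have hlt : z ^ #P < z ^ (K + 1) := lt_of_le_of_lt (hpow.trans hle) hNz
  rcases le_or_gt 1 z with hz1 | hz1
  · by_contra hK
    exact absurd (pow_le_pow_right₀ hz1 (Nat.succ_le_of_lt (not_le.mp hK))) (not_le.mpr hlt)
  · -- for `z < 1`: `N < z^{K+1} ≤ 1` forces `N = 0`, excluded
    exfalso
    have hN1 : (N : ℝ) < 1 := hNz.trans_le (pow_le_one₀ hz.le hz1.le)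
    have hN1' : N < 1 := by exact_mod_cast hN1
    omega

/-! ### The δ-blind window mass -/

/-- **Per-`n` count.**  For `1 ≤ n ≤ x` with `g(n) ≠ 0` and `|g(n)| < x^{c(K+1)}`, the moduli
`m ∈ roughDivWindow d δ c x` dividing `g(n)` number at most `2^K`. [folklore] -/
theorem card_filter_roughDivWindow_dvd_le {g : ℤ[X]} {n : ℕ} (hgn : g.eval (n : ℤ) ≠ 0)
    (d : ℕ) (δ : ℝ) {c : ℝ} {x : ℕ} (hxc : 0 < (x : ℝ) ^ c) {K : ℕ}
    (hsize : ((g.eval (n : ℤ)).natAbs : ℝ) < ((x : ℝ) ^ c) ^ (K + 1)) :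
    #((roughDivWindow d δ c x).filter fun m : ℕ => (m : ℤ) ∣ g.eval (n : ℤ)) ≤ 2 ^ K := by
  have hN : (g.eval (n : ℤ)).natAbs ≠ 0 := Int.natAbs_ne_zero.mpr hgn
  calc #((roughDivWindow d δ c x).filter fun m : ℕ => (m : ℤ) ∣ g.eval (n : ℤ))
      ≤ #((divWindow d δ x).filter fun m : ℕ => Squarefree m ∧
            (∀ p ∈ m.primeFactors, (x : ℝ) ^ c < (p : ℝ)) ∧ m ∣ (g.eval (n : ℤ)).natAbs) := by
        refine card_le_card fun m hm => ?_
        rw [mem_filter] at hm ⊢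
        obtain ⟨hmw, hdvd⟩ := hm
        unfold roughDivWindow at hmw
        rw [mem_filter] at hmw
        exact ⟨hmw.1, hmw.2.1, hmw.2.2, Int.natCast_dvd.mp hdvd⟩
    _ ≤ 2 ^ #((g.eval (n : ℤ)).natAbs.primeFactors.filter fun p : ℕ => (x : ℝ) ^ c < (p : ℝ)) :=
        card_filter_roughSqfree_dvd_le_two_pow _ hN _
    _ ≤ 2 ^ K := by
        refine Nat.pow_le_pow_right (by norm_num) ?_
        exact card_roughPrimeFactors_le hN hxc hsize

/-- **The δ-blind window-mass bound (T).**  For an irreducible `g` of degree `d ≥ 2` and any `c > 0`,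
every real `δ`: eventually in `x`,
`Σ_{m ∈ roughDivWindow d δ c x} #{1 ≤ n ≤ x : m ∣ g(n)} ≤ 2^{⌊(d+1)/c⌋} · x`.
(H1 = the same with `2^{⌊(d+1)/c⌋}` replaced by `C·δ`, `C` free of `δ`: the open atom.)  Proof: swap the
two counts; for each `n`, `g(n) ≠ 0` (irreducible of degree `≥ 2` has no integer root) and
`|g(n)| ≤ B·x^d < x^{d+1} ≤ (x^c)^{⌊(d+1)/c⌋+1}` for `x > B`, so `card_filter_roughDivWindow_dvd_le`
applies with `K = ⌊(d+1)/c⌋`. [folklore] -/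
theorem windowMass_le_two_pow_mul (g : ℤ[X]) (hg : Irreducible g) (hd : 2 ≤ g.natDegree)
    {c : ℝ} (hc : 0 < c) (δ : ℝ) :
    ∀ᶠ x : ℕ in atTop,
      (∑ m ∈ roughDivWindow g.natDegree δ c x,
        (#((Ioc 0 x).filter fun n : ℕ => (m : ℤ) ∣ g.eval (n : ℤ)) : ℝ)) ≤
        (2 : ℝ) ^ ⌊((g.natDegree : ℝ) + 1) / c⌋₊ * x := by
  set d := g.natDegree with hd_def
  set K : ℕ := ⌊((d : ℝ) + 1) / c⌋₊ with hK
  set B : ℤ := ∑ j ∈ range (d + 1), |g.coeff j| with hB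
  have hB0 : 0 ≤ B := Finset.sum_nonneg fun j _ => abs_nonneg _
  -- eventually: `x ≥ 2` and `x > B`
  have hev1 : ∀ᶠ x : ℕ in atTop, B.toNat + 2 ≤ x := eventually_ge_atTop _
  filter_upwards [hev1] with x hx
  have hx2 : 2 ≤ x := le_of_add_le_right hx
  have hx1 : (1 : ℝ) < x := by exact_mod_cast hx2
  have hx0 : (0 : ℝ) < x := by positivity
  have hxc : 0 < (x : ℝ) ^ c := Real.rpow_pos_of_pos hx0 c
  have hBx : (B : ℝ) < x := by
    have h1 : (B.toNat : ℝ) + 2 ≤ x := by exact_mod_cast hx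
    have h2 : (B : ℝ) ≤ (B.toNat : ℝ) := by exact_mod_cast Int.self_le_toNat B
    linarith
  -- the key size bound, uniformly in `1 ≤ n ≤ x`
  have hsize : ∀ n ∈ Ioc 0 x,
      ((g.eval (n : ℤ)).natAbs : ℝ) < ((x : ℝ) ^ c) ^ (K + 1) := by
    intro n hn
    rw [mem_Ioc] at hn
    have h1 : |g.eval (n : ℤ)| ≤ B * (x : ℤ) ^ d :=
      abs_eval_natCast_le_mul_pow g (Nat.succ_le_of_lt hn.1) hn.2
    have h1' : ((g.eval (n : ℤ)).natAbs : ℝ) ≤ (B : ℝ) * (x : ℝ) ^ d := by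
      rw [Nat.cast_natAbs]
      exact_mod_cast h1
    -- `B·x^d < x^{d+1}`
    have h2 : (B : ℝ) * (x : ℝ) ^ d < (x : ℝ) ^ ((d : ℝ) + 1) := by
      rw [Real.rpow_add hx0, Real.rpow_natCast, Real.rpow_one, mul_comm]
      exact mul_lt_mul_of_pos_left hBx (pow_pos hx0 d)
    -- `x^{d+1} ≤ (x^c)^{K+1}` since `d+1 ≤ c(K+1)`
    have h3 : (x : ℝ) ^ ((d : ℝ) + 1) ≤ ((x : ℝ) ^ c) ^ (K + 1) := by
      rw [← Real.rpow_natCast, ← Real.rpow_mul hx0.le]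
      refine Real.rpow_le_rpow_of_exponent_le hx1.le ?_
      have hK1 : ((d : ℝ) + 1) / c < (K : ℝ) + 1 := by
        rw [hK]; exact Nat.lt_floor_add_one _
      rw [div_lt_iff₀ hc] at hK1
      push_cast
      linarith
    exact lt_of_le_of_lt h1' (h2.trans_le h3)
  -- swap the double count
  have hswap : (∑ m ∈ roughDivWindow d δ c x,
      (#((Ioc 0 x).filter fun n : ℕ => (m : ℤ) ∣ g.eval (n : ℤ)) : ℝ)) =
      ∑ n ∈ Ioc 0 x, (#((roughDivWindow d δ c x).filter fun m : ℕ => (m : ℤ) ∣ g.eval (n : ℤ)) : ℝ) := by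
    have key : ∑ m ∈ roughDivWindow d δ c x, #((Ioc 0 x).filter fun n : ℕ => (m : ℤ) ∣ g.eval (n : ℤ)) =
        ∑ n ∈ Ioc 0 x, #((roughDivWindow d δ c x).filter fun m : ℕ => (m : ℤ) ∣ g.eval (n : ℤ)) := by
      calc ∑ m ∈ roughDivWindow d δ c x, #((Ioc 0 x).filter fun n : ℕ => (m : ℤ) ∣ g.eval (n : ℤ))
          = ∑ m ∈ roughDivWindow d δ c x, ∑ n ∈ Ioc 0 x,
              (if (m : ℤ) ∣ g.eval (n : ℤ) then 1 else 0) :=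
            Finset.sum_congr rfl fun m _ => Finset.card_filter _ _
        _ = ∑ n ∈ Ioc 0 x, ∑ m ∈ roughDivWindow d δ c x,
              (if (m : ℤ) ∣ g.eval (n : ℤ) then 1 else 0) := Finset.sum_comm
        _ = ∑ n ∈ Ioc 0 x, #((roughDivWindow d δ c x).filter fun m : ℕ => (m : ℤ) ∣ g.eval (n : ℤ)) :=
            Finset.sum_congr rfl fun n _ => (Finset.card_filter _ _).symm
    have key' := congrArg (fun t : ℕ => (t : ℝ)) key
    push_cast at key'
    exact key'
  rw [hswap]
  calc ∑ n ∈ Ioc 0 x, (#((roughDivWindow d δ c x).filter fun m : ℕ => (m : ℤ) ∣ g.eval (n : ℤ)) : ℝ)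
      ≤ ∑ n ∈ Ioc 0 x, (2 : ℝ) ^ K := by
        refine Finset.sum_le_sum fun n hn => ?_
        have := card_filter_roughDivWindow_dvd_le
          (eval_ne_zero_of_irreducible_of_two_le hg hd (n : ℤ)) d δ hxc (hsize n hn)
        exact_mod_cast this
    _ = (2 : ℝ) ^ K * x := by
        rw [Finset.sum_const, Nat.card_Ioc, Nat.sub_zero, nsmul_eq_mul]
        ring

/-- **S7 `stub_windowMassDeltaBlind`** (registered bookkeeping stub of the skeleton
`Cruxes/BalancedSemiprimeLayer/Lines/Ideator4Sketch.lean`, r4): the δ-blind window-mass bound in the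
registered `∀`-form — `windowMass_le_two_pow_mul`. [folklore] -/
theorem stub_windowMassDeltaBlind :
    ∀ g : ℤ[X], Irreducible g → 2 ≤ g.natDegree → ∀ c : ℝ, 0 < c → ∀ δ : ℝ,
      ∀ᶠ x : ℕ in atTop,
        (∑ m ∈ roughDivWindow g.natDegree δ c x,
          (#((Ioc 0 x).filter fun n : ℕ => (m : ℤ) ∣ g.eval (n : ℤ)) : ℝ)) ≤
          (2 : ℝ) ^ ⌊((g.natDegree : ℝ) + 1) / c⌋₊ * x :=
  fun g hg hd _c hc δ => windowMass_le_two_pow_mul g hg hd hc δ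

end Summit.Parity.BatemanHorn.Cruxes.BalancedSemiprimeLayer.RelativeMassSplit

end
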